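import Mathlib
import HarnessLib
import Literature.Computability.AlgebraicComplexity.PatternExpressions
import Literature.Computability.AlgebraicComplexity.DiPatternExpressions
import Summits.ValiantsHypothesis.ValiantsHypothesis.Theorems.MonotoneRestorationOrbitCompressionQPDiCompressionFloors
import Summits.ValiantsHypothesis.ValiantsHypothesis.Theorems.MonotoneRestorationOrbitRestorationLinearVolumeQPDiUnfolding
import Summits.ValiantsHypothesis.ValiantsHypothesis.Theorems.MonotoneRestorationOrbitRestorationLinearVolumeQPSubThresholdDescent
import Summits.ValiantsHypothesis.ValiantsHypothesis.Theorems.MonotoneRestorationOrbitRestorationLinearVolumeQPBlockDescent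

/-!
# Route MonotoneRestoration — aside `OrbitRestorationLinearVolumeQP` (stmt-ValiantsHypothesis-18294) /
# crux `OrbitRestorationQP` (stmt-18293): BIPARTITE UNFOLDING FLOORS — a closed BIPARTITE expression with `k` row
# and `l` column labels is one-sortedly narrow of width `k + l - 1` at every level, bipartitely narrow of the same
# width below the injective threshold, and bipartitely narrow of the same width ONE LEVEL DOWN

Census item (3)/(b) of the line-`birth` hands (6-g0, 5-g2, 8-g0: "bipartite unfolding `PatternExpr k l ⟹
span{hom_F : tw F ≤ k + l - 1}` (K1ᵉ ⟹ K1) — M, needs a 2-colouring-refined copy of the DiUnfolding induction").  Three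
floors of it follow at once from tree theorems, with NO new induction:

* `close_mem_span_diHomPoly` — **ONE-SORTED UNFOLDING OF BIPARTITE EXPRESSIONS, IN FULL:** for every
  `e : PatternExpr ℂ k l` and every `n`, `e.close n ∈ span{dihom_{D,n} : tw D ≤ k + l - 1}` (a bipartite expression is
  a one-sorted expression with `k + l` labels and the same closed polynomial, `CompressionFloors.exists_diClose_eq_close`;
  then the one-sorted unfolding `DiUnfolding.close_mem_span_diHomPoly`, p829010);
* `close_mem_narrowSpan_of_halfDegree` — **BIPARTITE UNFOLDING BELOW THE THRESHOLD:** if `2 · deg (e.close n) ≤ n`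
  then `e.close n ∈ span{hom_{F,n} : tw F ≤ k + l - 1}` (closed expressions are matrix-symmetric,
  `PatternExpr.rename_perm_close`; sub-threshold descent `SubThresholdDescent.subThreshold_descent`, p827466);
* `block_close_mem_narrowSpan` — **BIPARTITE UNFOLDING ONE LEVEL DOWN, EVERY DEGREE:** the off-diagonal-block
  restriction of `e.close (n + n)` lies in `span{hom_{F,n} : tw F ≤ k + l - 1}` (block descent,
  `BlockDescent.block_descent_span`; the principal-block reading follows with
  `BlockDescentLift.principal_mem_narrowSpan_of_mem_diNarrowSpan`, closed expressions being matrix-symmetric).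

What remains of K1ᵉ ⟹ K1 is the same-level statement in degrees `> n/2` (the 2-colouring-refined unfolding); it is
bookkeeping for the parent crux, not load-bearing for R1.  Honest label: corollaries; the stub `stub_lvNarrowSpan`, R1
and VP ≠ VNP are NOT moved.  Def-free, route-independent helper (`--supports stmt-ValiantsHypothesis-18294`); nothing here is a named fact.

References: Dawar–Pago–Seppelt 2025 (arXiv:2502.06740) §5, §7 p. 45; Dwivedi–Pago–Seppelt 2026 (arXiv:2601.09343)
eq. (1).
-/

noncomputable section

open scoped Classical

-- `Summit.ValiantsHypothesis.ValiantsHypothesis.…` is the tree's single-conjunct layout (Sub = Summit).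
set_option linter.dupNamespace false

namespace Summit.ValiantsHypothesis.ValiantsHypothesis.Theorems.BipartiteUnfolding

open Literature.Computability.AlgebraicComplexity MvPolynomial
open Literature.Combinatorics.SimpleGraph (treewidth)
open Summit.ValiantsHypothesis.ValiantsHypothesis.Theorems

/-- **One-sorted unfolding of a bipartite expression, every level, every degree.**  The closed polynomial of a
labelled bipartite pattern expression with `k` row and `l` column labels lies in the span of the one-sorted
homomorphism polynomials of patterns of treewidth `≤ k + l - 1`. [folklore] -/
theorem close_mem_span_diHomPoly (k l n : ℕ) (e : PatternExpr ℂ k l) :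
    e.close n ∈ Submodule.span ℂ {q : MvPolynomial (Fin n × Fin n) ℂ |
      ∃ (a : ℕ) (D : Multiset (Fin a × Fin a)),
        treewidth (SimpleGraph.fromRel fun u v : Fin a => ∃ e ∈ D, u = e.1 ∧ v = e.2) ≤ k + l - 1 ∧
          q = diHomPoly D n ℂ} := by
  obtain ⟨e', -, he'⟩ := CompressionFloors.exists_diClose_eq_close n e
  rw [← he']
  exact DiUnfolding.close_mem_span_diHomPoly (k + l) n e'

/-- **Bipartite unfolding below the injective threshold.**  If `2 · deg (e.close n) ≤ n`, the closed polynomial of a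
bipartite expression with `k` row and `l` column labels lies in the span of the BIPARTITE homomorphism polynomials of
treewidth `≤ k + l - 1` (K1ᵉ ⟹ K1 on half-degree levels). [folklore] -/
theorem close_mem_narrowSpan_of_halfDegree (k l n : ℕ) (e : PatternExpr ℂ k l)
    (hdeg : 2 * (e.close n).totalDegree ≤ n) :
    e.close n ∈ Submodule.span ℂ {q : MvPolynomial (Fin n × Fin n) ℂ |
      ∃ (a b : ℕ) (F : Multiset (Fin a × Fin b)),
        treewidth (SimpleGraph.fromRel fun u v : Fin a ⊕ Fin b =>
            ∃ e ∈ F, u = Sum.inl e.1 ∧ v = Sum.inr e.2) ≤ k + l - 1 ∧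
          q = homPoly F n ℂ} :=
  SubThresholdDescent.subThreshold_descent n (k + l - 1) _
    (fun σ τ => PatternExpr.rename_perm_close n σ τ e) hdeg (close_mem_span_diHomPoly k l n e)

/-- **Bipartite unfolding one level down (off-diagonal block), every degree.**  For an off-diagonal block
substitution `φ` (level `n + n` → level `n`), `φ(e.close (n + n))` lies in the span of the bipartite homomorphism
polynomials of treewidth `≤ k + l - 1` at level `n`. [folklore] -/
theorem block_close_mem_narrowSpan (k l n : ℕ)
    (φ : Fin (n + n) × Fin (n + n) → MvPolynomial (Fin n × Fin n) ℂ)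
    (hφ : ∀ i j : Fin n, φ (finSumFinEquiv (Sum.inl i), finSumFinEquiv (Sum.inr j)) = X (i, j) ∧
      φ (finSumFinEquiv (Sum.inl i), finSumFinEquiv (Sum.inl j)) = 0 ∧
      φ (finSumFinEquiv (Sum.inr i), finSumFinEquiv (Sum.inl j)) = 0 ∧
      φ (finSumFinEquiv (Sum.inr i), finSumFinEquiv (Sum.inr j)) = 0)
    (e : PatternExpr ℂ k l) :
    aeval φ (e.close (n + n)) ∈ Submodule.span ℂ {q : MvPolynomial (Fin n × Fin n) ℂ |
      ∃ (a b : ℕ) (F : Multiset (Fin a × Fin b)),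
        treewidth (SimpleGraph.fromRel fun u v : Fin a ⊕ Fin b =>
            ∃ e ∈ F, u = Sum.inl e.1 ∧ v = Sum.inr e.2) ≤ k + l - 1 ∧
          q = homPoly F n ℂ} :=
  BlockDescent.block_descent_span φ hφ (k + l - 1) _ (close_mem_span_diHomPoly k l (n + n) e)

end Summit.ValiantsHypothesis.ValiantsHypothesis.Theorems.BipartiteUnfolding

end
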